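import Mathlib
import Summits.MatrixMultiplication.MatrixMultiplication.Theses.LevelGradedCohnUmans
import Summits.MatrixMultiplication.MatrixMultiplication.Cruxes.LieRankDesigns.IdeatorSketch2

/-!
# Crux `LevelOneGL2Designs` (stmt-MatrixMultiplication-14080) — ideator 1, round 1: first lemmas

Two idea cards (`Cruxes/LevelOneGL2Designs/Ideas/`):

* `quotient-sandwich-flag-transfer` — TPP ⇔ `Q(X) ∩ Q(Z) = {1} ∧ Q(Y) ∩ Q(X)·Q(Z) = {1}`
  (`Q(S) = S S⁻¹`), the forbidden set contains a translate of `X⁻¹Z`, and for the FLAG ARCHITECTURE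
  `X = C₁·U`, `Z = C₂·U⁻` (central chunks times root groups) the TPP condition on the middle set `K`
  is an explicit determinant-graded point–line FLAG CODE in `AG(2,p)` (`flag_tpp_criterion`).
* `stabiliser-quotient-separation` — a rank-1 SINGLE-LINE separator for the target `(x₀,z₀)` exists as
  soon as the based triple products avoid the stabiliser of one vector (`rankSep_of_basedTPP_modStab`),
  and inside a Borel coset the level-1 ghosts are exactly the toral zero-margin functions
  (`borel_rankSeparated_of_tpp_offU`).

Everything is stated over the crux's own clause (`Ideator2.RankSeparated`, definitionally the inlined
separation clause of `LevelGradedCohnUmans.LevelOneGL2Designs`) and Mathlib.  Statements only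
(`sorry`), they must ELABORATE; proofs are crux-plan business.
-/

open scoped BigOperators

set_option linter.dupNamespace false

namespace Summit.MatrixMultiplication.MatrixMultiplication.Cruxes.LevelOneGL2Designs.Ideator1

open Summit.MatrixMultiplication.MatrixMultiplication.Cruxes.LieRankDesigns.Ideator2 (GLp RankSeparated)

abbrev Mat (p : ℕ) := Matrix (Fin 2) (Fin 2) (ZMod p)

section Sandwich

variable {G : Type} [Group G] [DecidableEq G]

/-- Right quotient set `Q(S) = S·S⁻¹`. -/
def quot (S : Finset G) : Finset G := (S ×ˢ S).image fun q => q.1 * q.2⁻¹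

/-- Product set `A·B`. -/
def prodSet (A B : Finset G) : Finset G := (A ×ˢ B).image fun q => q.1 * q.2

/-- TPP in the crux's quadruple form (`y = y'` convention of the separation clause). -/
def TPP (X Y Z : Finset G) : Prop :=
  ∀ x₀ ∈ X, ∀ z₀ ∈ Z, ∀ x ∈ X, ∀ y ∈ Y, ∀ y' ∈ Y, ∀ z ∈ Z,
    x⁻¹ * y * y'⁻¹ * z = x₀⁻¹ * z₀ → x = x₀ ∧ y = y' ∧ z = z₀

/-- **QUOTIENT-SET SANDWICH.** `TPP(X,Y,Z) ⇔ Q(X) ∩ Q(Z) = {1} ∧ Q(Y) ∩ Q(X)Q(Z) = {1}`: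
a violation `(x₀x⁻¹)(yy'⁻¹)(zz₀⁻¹) = 1` is exactly a middle quotient lying in the forbidden set
`𝔉 = Q(X)·Q(Z)`; so for fixed `(X,Z)` the best middle set is a maximum independent set of the Cayley
graph `Cay(G, 𝔉 ∪ 𝔉⁻¹)`. [elementary] -/
theorem tpp_iff_sandwich (X Y Z : Finset G) (hY : Y.Nonempty) :
    TPP X Y Z ↔ quot X ∩ quot Z ⊆ {1} ∧ quot Y ∩ prodSet (quot X) (quot Z) ⊆ {1} := by
  sorry

/-- **The forbidden set is never small**: it contains the translate `x₀·(X⁻¹Z)·z₀⁻¹`, and under TPP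
`|X⁻¹Z| = |X||Z|`; hence `|Q(X)Q(Z)| ≥ |X|·|Z|` — the source of the `p⁴` wall (a random-like middle
set has size `≲ |G|/|𝔉| ≤ p⁴/(c²p³)`). [elementary] -/
theorem card_mul_card_le_card_forbidden (X Y Z : Finset G) (hY : Y.Nonempty) (h : TPP X Y Z) :
    X.card * Z.card ≤ (prodSet (quot X) (quot Z)).card := by
  sorry

end Sandwich

section Flag

variable (p : ℕ) [Fact p.Prime]

/-- The scalar matrix `z·1` as an element of `GL_2(𝔽_p)`. -/
noncomputable def scal (z : (ZMod p)ˣ) : GLp 2 p :=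
  Matrix.GeneralLinearGroup.mkOfDetNeZero !![(z : ZMod p), 0; 0, (z : ZMod p)]
    (by simp [Matrix.det_fin_two])

/-- Upper root element `u_b`. -/
noncomputable def uUp (b : ZMod p) : GLp 2 p :=
  Matrix.GeneralLinearGroup.mkOfDetNeZero !![1, b; 0, 1] (by simp [Matrix.det_fin_two])

/-- Lower root element `v_c`. -/
noncomputable def uLow (c : ZMod p) : GLp 2 p :=
  Matrix.GeneralLinearGroup.mkOfDetNeZero !![1, 0; c, 1] (by simp [Matrix.det_fin_two])

/-- `X = C₁·U` (central chunk times the upper root group). -/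
noncomputable def flagX (C₁ : Finset (ZMod p)ˣ) : Finset (GLp 2 p) :=
  (C₁ ×ˢ (Finset.univ : Finset (ZMod p))).image fun q => scal p q.1 * uUp p q.2

/-- `Z = C₂·U⁻`. -/
noncomputable def flagZ (C₂ : Finset (ZMod p)ˣ) : Finset (GLp 2 p) :=
  (C₂ ×ˢ (Finset.univ : Finset (ZMod p))).image fun q => scal p q.1 * uLow p q.2

/-- The flag pairing `w(k,k') = k₂₂ k'₁₁ − k₂₁ k'₁₂ = ⟨ρ_k, σ_{k'}⟩`
(second row of `k` against the rotated first row of `k'`; `w(k,k) = det k`). -/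
def flagPair (k k' : GLp 2 p) : ZMod p :=
  (k : Mat p) 1 1 * (k' : Mat p) 0 0 - (k : Mat p) 1 0 * (k' : Mat p) 0 1

/-- **FLAG CRITERION** (card `quotient-sandwich-flag-transfer`, verified numerically at `p = 7, 11`:
96 resp. 1040 violating pairs predicted exactly, kit/flagcode.py).  With `X = C₁U`, `Z = C₂U⁻`,
`Γ = (C₁C₁⁻¹)(C₂C₂⁻¹)` and `C₁C₁⁻¹ ∩ C₂C₂⁻¹ = {1}`: `Q(X)Q(Z) = Γ·UU⁻ = {g : det g = g₂₂², g₂₂ ∈ Γ}`,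
so `(X, K, Z)` is TPP iff no ordered pair `k ≠ k'` of `K` has `w² = det k · det k'` and `w ∈ det k'·Γ`,
`w = flagPair k k'`.  Same determinant class `d`: `⟨ρ_k, σ_{k'}⟩ ≠ ±d` = the INDUCED-MATCHING
(tangency) condition for the flags (point `σ_k`, line `⟨ρ_k,·⟩ = d`) of `AG(2,p)`; classes with
`dd'` a non-square never interact. -/
theorem flag_tpp_criterion (hp : p ≠ 2) (C₁ C₂ : Finset (ZMod p)ˣ) (K : Finset (GLp 2 p))
    (hC : ∀ a ∈ C₁, ∀ a' ∈ C₁, ∀ d ∈ C₂, ∀ d' ∈ C₂, a * a'⁻¹ = d * d'⁻¹ → a = a' ∧ d = d')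
    (hK : K.Nonempty) :
    TPP (flagX p C₁) K (flagZ p C₂) ↔
      ∀ k ∈ K, ∀ k' ∈ K, k ≠ k' →
        ¬ (flagPair p k k' ^ 2 = (k : Mat p).det * (k' : Mat p).det ∧
            ∃ a ∈ C₁, ∃ a' ∈ C₁, ∃ d ∈ C₂, ∃ d' ∈ C₂,
              flagPair p k k' = (k' : Mat p).det * ((a * a'⁻¹ * (d * d'⁻¹) : (ZMod p)ˣ) : ZMod p)) := by
  sorry

/-- **TRANSFER TARGET (packing half).** Tangency sets at the Bruen–Thas scale in planes of PRIME
order: `c·p^{3/2}` point–line flags `(s_i ∈ L_i)` of `AG(2,p)`, lines `⟨r_i, x⟩ = 1`, with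
`s_i ∈ L_j ⇔ i = j`, along an unbounded set of primes.  (Unitals give `q√q + 1` for SQUARE `q` — the
`SU_2` of CU2003 Prop. 11; conics give `p`; random greedy gives `≈ p log p`, kit j012640.) -/
def TangencySets : Prop :=
  ∃ c : ℝ, 0 < c ∧ ∀ p₀ : ℕ, ∃ (p : ℕ) (_ : Fact p.Prime), p₀ ≤ p ∧
    ∃ S : Finset ((Fin 2 → ZMod p) × (Fin 2 → ZMod p)),
      c * (p : ℝ) ^ (3 / 2 : ℝ) ≤ S.card ∧
      ∀ f ∈ S, ∀ f' ∈ S, (dotProduct f.1 f'.2 = 1 ↔ f = f')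

end Flag

section Separation

variable (p : ℕ) [Fact p.Prime]

/-- **SINGLE-LINE SEPARATORS** (card `stabiliser-quotient-separation`): the level-1 test
`g ↦ 1[g·v = (x₀⁻¹z₀)·v]` has Fourier rank `≤ 1` (`1[gv = v₀] = p⁻² Σ_ξ ψ(-ξ·v₀) ψ(tr((v ξᵀ) g))`,
`rk(vξᵀ) ≤ 1`) and separates the target `(x₀, z₀)` as soon as the BASED products
`x₀x⁻¹·yy'⁻¹·zz₀⁻¹` fix the vector `z₀v` only trivially — TPP modulo the stabiliser of one vector. -/
theorem rankSep_of_basedTPP_modStab (X Y Z : Finset (GLp 2 p))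
    (h : ∀ x₀ ∈ X, ∀ z₀ ∈ Z, ∃ v : Fin 2 → ZMod p, v ≠ 0 ∧
      ∀ x ∈ X, ∀ y ∈ Y, ∀ y' ∈ Y, ∀ z ∈ Z,
        Matrix.mulVec ((x⁻¹ * y * y'⁻¹ * z : GLp 2 p) : Mat p) v
          = Matrix.mulVec ((x₀⁻¹ * z₀ : GLp 2 p) : Mat p) v → x = x₀ ∧ y = y' ∧ z = z₀) :
    RankSeparated p 2 1 X Y Z := by
  sorry

/-- **GHOSTS INSIDE A BOREL COSET** (card `stabiliser-quotient-separation`): if `X, Y, Z` lie in the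
upper Borel `B`, the level-1 ghost space on `B` is the `(p-2)²`-dimensional space of `U`-invariant
toral functions with zero row/column sums (the doubly non-trivial linear characters of `B`); hence a
TPP triple whose quadruple-product set `P = X⁻¹YY⁻¹Z` contains NO full `U`-coset through a target is
rank-1 separated.  (Inside one Borel the crux is therefore plain graded Cohn–Umans in
`C_{p-1} × AGL_1(p)`.) -/
theorem borel_rankSeparated_of_tpp_offU (X Y Z : Finset (GLp 2 p))
    (hB : ∀ g ∈ X ∪ Y ∪ Z, (g : Mat p) 1 0 = 0)
    (hT : TPP X Y Z)
    (hU : ∀ x₀ ∈ X, ∀ z₀ ∈ Z, ∃ b : ZMod p,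
      ∀ x ∈ X, ∀ y ∈ Y, ∀ y' ∈ Y, ∀ z ∈ Z,
        x⁻¹ * y * y'⁻¹ * z ≠ x₀⁻¹ * z₀ *
          Matrix.GeneralLinearGroup.mkOfDetNeZero !![(1 : ZMod p), b; 0, 1]
            (by simp [Matrix.det_fin_two])) :
    RankSeparated p 2 1 X Y Z := by
  sorry

end Separation

/-- **ASSEMBLY OF THE LINE** (how the two cards would close the crux, by name): tangency sets at scale
`c p^{3/2}` feed the flag architecture with `|C₁| = |C₂| ≈ √p`; the middle set is a determinant-graded
flag code of size `≥ c' p^{3/2}` (criterion above); separation is then the based-TPP-mod-stabiliser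
condition for the flag design (`FlagSeparation`, to be stated by crux-plan once kit j012643/j012645
report the census).  The composition is the crux decl itself. -/
theorem levelOneGL2Designs_of_flagLine
    (hpack : TangencySets)
    (hflag : TangencySets →
      Summit.MatrixMultiplication.MatrixMultiplication.Theses.LevelGradedCohnUmans.LevelOneGL2Designs) :
    Summit.MatrixMultiplication.MatrixMultiplication.Theses.LevelGradedCohnUmans.LevelOneGL2Designs :=
  hflag hpack

end Summit.MatrixMultiplication.MatrixMultiplication.Cruxes.LevelOneGL2Designs.Ideator1
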